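import Mathlib
import HarnessLib

/-!
# Box means shrinking to the origin (`stub_boxMeanVanish`)

Summit `QuantumFields/YangMills`, thesis `PencilRigidity.ShellRigidity` (stmt-QuantumFields-11685),
line `thales-slit-exact-cone-type`, stub P3 (helper for the lead's `stub_transversePinch`).

A continuous function `c` on `ℝ²` all of whose double box means
`∫_{[0,δ]²} ∫_{[0,δ]²} c (w - w') dw' dw` (`0 < δ < 1`) vanish has `c 0 = 0`.  This is the
approximate-identity step: for `w, w' ∈ [0,δ]²` the difference `w - w'` has sup norm `≤ δ`, so
`|∫∫ c (w - w') - δ⁴ c 0| ≤ δ⁴ sup_{‖v‖_∞ ≤ δ} |c v - c 0|`, which is `< δ⁴ |c 0| / 2` for small `δ`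
if `c 0 ≠ 0` — contradicting the vanishing of the mean.  The only analytic inputs are continuity of
the parametric integral `w ↦ ∫_{[0,δ]²} c (w - w') dw'` (Mathlib's
`continuous_parametric_integral_of_continuous`), which makes the outer integrand integrable, and the
elementary bound `‖∫_s f‖ ≤ C · vol s`.  Mathlib only; no named facts. [folklore]
-/

noncomputable section

namespace Summit.QuantumFields.YangMills.Cruxes.ShellRigidity.ThalesSlitExactConeType

open MeasureTheory Complex Real
open scoped InnerProductSpace BigOperators

namespace BoxMeanVanish

/-- The box `[0,δ]² ⊂ ℝ²` has Lebesgue measure `δ²` (as a real number) when `0 ≤ δ`. [folklore] -/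
theorem volume_real_box {δ : ℝ} (hδ : 0 ≤ δ) :
    (volume : Measure (ℝ × ℝ)).real (Set.Icc (0 : ℝ) δ ×ˢ Set.Icc (0 : ℝ) δ) = δ * δ := by
  rw [Measure.volume_eq_prod ℝ ℝ, measureReal_prod_prod, Real.volume_real_Icc, sub_zero,
    max_eq_left hδ]

/-- Sup-metric control of differences of points of the box: if `w, w' ∈ [0,δ]²` and `δ < r` then
`dist (w - w') 0 < r` in `ℝ × ℝ`. [folklore] -/
theorem dist_sub_lt {δ r : ℝ} (hδr : δ < r) {w w' : ℝ × ℝ}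
    (hw : w ∈ Set.Icc (0 : ℝ) δ ×ˢ Set.Icc (0 : ℝ) δ)
    (hw' : w' ∈ Set.Icc (0 : ℝ) δ ×ˢ Set.Icc (0 : ℝ) δ) :
    dist (w.1 - w'.1, w.2 - w'.2) (0 : ℝ × ℝ) < r := by
  simp only [Set.mem_prod, Set.mem_Icc] at hw hw'
  obtain ⟨⟨h1a, h1b⟩, ⟨h2a, h2b⟩⟩ := hw
  obtain ⟨⟨h1a', h1b'⟩, ⟨h2a', h2b'⟩⟩ := hw'
  rw [dist_zero_right, Prod.norm_mk, Real.norm_eq_abs, Real.norm_eq_abs]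
  refine max_lt (abs_lt.2 ⟨?_, ?_⟩) (abs_lt.2 ⟨?_, ?_⟩) <;> linarith

end BoxMeanVanish

open BoxMeanVanish in
/-- **Stub P3 · box means shrinking to the origin (approximate identity).** A continuous function on
`ℝ²` all of whose double box means `∫_{[0,δ]²}∫_{[0,δ]²} c(w - w') dw dw'` (`0 < δ < 1`) vanish has
`c(0) = 0`: `|∫∫ c(w-w') - δ⁴ c(0)| ≤ δ⁴ sup_{|v|_∞ ≤ δ} |c(v) - c(0)| = o(δ⁴)`. Helper for
`stub_transversePinch`. [folklore] -/
theorem stub_boxMeanVanish (c : ℝ × ℝ → ℝ) (hc : Continuous c)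
    (hzero : ∀ δ : ℝ, 0 < δ → δ < 1 →
      ∫ w in Set.Icc (0 : ℝ) δ ×ˢ Set.Icc (0 : ℝ) δ, ∫ w' in Set.Icc (0 : ℝ) δ ×ˢ Set.Icc (0 : ℝ) δ,
        c (w.1 - w'.1, w.2 - w'.2) = 0) :
    c 0 = 0 := by
  by_contra h0
  have hη : 0 < |c 0| / 2 := by positivity
  obtain ⟨r, hr, hrc⟩ := Metric.continuous_iff.1 hc 0 (|c 0| / 2) hη
  -- the size of the box: `0 < δ < 1` and `δ < r`
  obtain ⟨δ, hδpos, hδ1, hδr⟩ : ∃ δ : ℝ, 0 < δ ∧ δ < 1 ∧ δ < r :=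
    ⟨min (r / 2) (1 / 2), lt_min (by positivity) (by norm_num),
      (min_le_right _ _).trans_lt (by norm_num), (min_le_left _ _).trans_lt (by linarith)⟩
  have hI := hzero δ hδpos hδ1
  generalize hQ : Set.Icc (0 : ℝ) δ ×ˢ Set.Icc (0 : ℝ) δ = Q at hI
  have hQc : IsCompact Q := hQ ▸ isCompact_Icc.prod isCompact_Icc
  have hQtop : volume Q < ⊤ := hQc.measure_lt_top
  have hQreal : volume.real Q = δ * δ := hQ ▸ volume_real_box hδpos.le
  -- pointwise closeness of `c (w - w')` to `c 0` on the box
  have hpt : ∀ w ∈ Q, ∀ w' ∈ Q, ‖c (w.1 - w'.1, w.2 - w'.2) - c 0‖ ≤ |c 0| / 2 := by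
    intro w hw w' hw'
    rw [← hQ] at hw hw'
    have h := hrc (w.1 - w'.1, w.2 - w'.2) (dist_sub_lt hδr hw hw')
    rw [dist_eq_norm] at h
    exact h.le
  -- the inner integrand is continuous, hence integrable on the box
  have hinner : ∀ w : ℝ × ℝ,
      IntegrableOn (fun w' : ℝ × ℝ => c (w.1 - w'.1, w.2 - w'.2)) Q volume :=
    fun w => (hc.comp (by fun_prop)).continuousOn.integrableOn_compact hQc
  -- inner estimate
  have hin : ∀ w ∈ Q,
      ‖(∫ w' in Q, c (w.1 - w'.1, w.2 - w'.2)) - δ * δ * c 0‖ ≤ |c 0| / 2 * (δ * δ) := by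
    intro w hw
    have hsub : ∫ w' in Q, (c (w.1 - w'.1, w.2 - w'.2) - c 0)
        = (∫ w' in Q, c (w.1 - w'.1, w.2 - w'.2)) - δ * δ * c 0 := by
      rw [integral_sub (hinner w) (integrableOn_const hQtop.ne), setIntegral_const, hQreal,
        smul_eq_mul]
    calc ‖(∫ w' in Q, c (w.1 - w'.1, w.2 - w'.2)) - δ * δ * c 0‖
        = ‖∫ w' in Q, (c (w.1 - w'.1, w.2 - w'.2) - c 0)‖ := by rw [hsub]
      _ ≤ |c 0| / 2 * volume.real Q :=
          norm_setIntegral_le_of_norm_le_const hQtop fun w' hw' => hpt w hw w' hw'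
      _ = |c 0| / 2 * (δ * δ) := by rw [hQreal]
  -- the outer integrand is a continuous parametric integral, hence integrable on the box
  have hg : Continuous fun w : ℝ × ℝ => ∫ w' in Q, c (w.1 - w'.1, w.2 - w'.2) :=
    continuous_parametric_integral_of_continuous
      (f := fun (w : ℝ × ℝ) (w' : ℝ × ℝ) => c (w.1 - w'.1, w.2 - w'.2)) (hc.comp (by fun_prop)) hQc
  have hgint : IntegrableOn (fun w : ℝ × ℝ => ∫ w' in Q, c (w.1 - w'.1, w.2 - w'.2)) Q volume :=
    hg.continuousOn.integrableOn_compact hQc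
  -- outer estimate
  have hout : ‖(∫ w in Q, ∫ w' in Q, c (w.1 - w'.1, w.2 - w'.2)) - δ * δ * (δ * δ * c 0)‖
      ≤ |c 0| / 2 * (δ * δ) * (δ * δ) := by
    have hsub : ∫ w in Q, ((∫ w' in Q, c (w.1 - w'.1, w.2 - w'.2)) - δ * δ * c 0)
        = (∫ w in Q, ∫ w' in Q, c (w.1 - w'.1, w.2 - w'.2)) - δ * δ * (δ * δ * c 0) := by
      rw [integral_sub hgint (integrableOn_const hQtop.ne), setIntegral_const, hQreal, smul_eq_mul]
    calc ‖(∫ w in Q, ∫ w' in Q, c (w.1 - w'.1, w.2 - w'.2)) - δ * δ * (δ * δ * c 0)‖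
        = ‖∫ w in Q, ((∫ w' in Q, c (w.1 - w'.1, w.2 - w'.2)) - δ * δ * c 0)‖ := by rw [hsub]
      _ ≤ |c 0| / 2 * (δ * δ) * volume.real Q := norm_setIntegral_le_of_norm_le_const hQtop hin
      _ = |c 0| / 2 * (δ * δ) * (δ * δ) := by rw [hQreal]
  -- conclusion: `δ⁴ |c 0| ≤ δ⁴ |c 0| / 2` with `δ⁴ |c 0| > 0`
  have hkey : δ * δ * (δ * δ) * |c 0| ≤ |c 0| / 2 * (δ * δ) * (δ * δ) := by
    calc δ * δ * (δ * δ) * |c 0|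
        = ‖(∫ w in Q, ∫ w' in Q, c (w.1 - w'.1, w.2 - w'.2)) - δ * δ * (δ * δ * c 0)‖ := by
          rw [hI, zero_sub, norm_neg, Real.norm_eq_abs]
          simp only [abs_mul, abs_of_pos hδpos]
          ring
      _ ≤ |c 0| / 2 * (δ * δ) * (δ * δ) := hout
  have hpos : 0 < δ * δ * (δ * δ) * |c 0| := mul_pos (by positivity) (abs_pos.2 h0)
  linarith

end Summit.QuantumFields.YangMills.Cruxes.ShellRigidity.ThalesSlitExactConeType
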